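import Literature.NumberTheory.Transcendental.KZLogCalculusProofs
import Literature.NumberTheory.Transcendental.KZSemialgebraicComplex
import Summits.KontsevichZagierPeriods.KontsevichZagierPeriods.Theorems.HurwitzMicroSectorsNormalFormPrincipleLevelOneExistsRep

/-!
# `NormalFormPrinciple` (stmt-KontsevichZagierPeriods-3869), line `SketchIdeator1` —
# leaf `stub_boxRigidity`, dilogarithm layer: the box atoms exist

Pure proof file (stub `exists_boxAtoms` of the layer `Dilog`, lead seat c9; `--supports` the crux).
The dilogarithm functional equations (reflection, Landen, duplication) are proved by the lead as
move chains of the Kontsevich–Zagier calculus between three families of *atoms*, all supported on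
the open unit box `□ = (0,1)² ⊆ ℝ²`:

* the dilogarithm box `D(a) = [□, 1/(a − x₀x₁)]` for real algebraic `a` with `a ≥ 1` or `a < 0`
  (value `Li₂(1/a)`; `D(1)` is Beukers' `ζ(2)` box);
* the log-product box `P(b,c) = [□, 1/((b + x₀)(c + x₁))]` for real algebraic `b, c > 0`
  (value `log(1 + 1/b)·log(1 + 1/c)`);
* the squares-substitution box `W(a) = [□, 4x₀x₁/(a² − x₀²x₁²)]` for real algebraic `a` with
  `|a| ≥ 1` (the pull-back of `D(a²)` along `(x₀, x₁) ↦ (x₀², x₁²)`).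

This file supplies their EXISTENCE as honest integral representations
(`Literature.NumberTheory.Transcendental.KZ.IntegralRep 2`): the box is `ℚ`-semialgebraic
(`KZ.isSemialgebraic_box`); each integrand is a rational function of the coordinates and one real
algebraic constant, hence a `ℚ`-semialgebraic function on the box
(`isSemialgebraicFunOn_const_of_isAlgebraic` and the ring/quotient closure of semialgebraic
functions); and each integrand is continuous on the open box and dominated there by a constant
multiple of Beukers' kernel `1/(1 − x₀x₁)`, which is integrable on the box
(`LevelOne.integrableOn_aeval_div_one_sub_mul`, seat c7), so the integrals converge absolutely.

References: M. Kontsevich, D. Zagier, *Periods* (2001), §1.1; F. Beukers, *A note on the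
irrationality of ζ(2) and ζ(3)*, Bull. LMS 11 (1979). No definitions are introduced.
-/

noncomputable section

open MeasureTheory Set
open Literature.NumberTheory.Transcendental Literature.NumberTheory.Transcendental.KZ
open Literature.ModelTheory.ExponentialFields (IsSemialgebraic)

namespace Summit.KontsevichZagierPeriods.HurwitzMicroSectors.NormalFormPrinciple.PiBox.Dilog

/-! ## Elementary inequalities on the open unit box -/

/-- On the open unit box of `ℝ²` the product of the coordinates lies in `(0,1)`. [folklore] -/
theorem mul_mem_Ioo_of_mem_box {x : Fin 2 → ℝ} (hx : ∀ i, x i ∈ Set.Ioo (0:ℝ) 1) :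
    x 0 * x 1 ∈ Set.Ioo (0:ℝ) 1 :=
  ⟨mul_pos (hx 0).1 (hx 1).1,
    mul_lt_one_of_nonneg_of_lt_one_left (hx 0).1.le (hx 0).2 (hx 1).2.le⟩

/-- The dilogarithm denominator `a − x₀x₁` does not vanish on the open unit box when `a ≥ 1` or
`a < 0`. [folklore] -/
theorem dilogDen_ne_zero {a : ℝ} (ha : 1 ≤ a ∨ a < 0) {x : Fin 2 → ℝ}
    (hx : ∀ i, x i ∈ Set.Ioo (0:ℝ) 1) : a - x 0 * x 1 ≠ 0 := by
  have hp := mul_mem_Ioo_of_mem_box hx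
  rcases ha with ha | ha
  · exact (show (0:ℝ) < a - x 0 * x 1 by linarith [hp.2]).ne'
  · exact (show a - x 0 * x 1 < 0 by linarith [hp.1]).ne

/-- Domination of the dilogarithm integrand for `a ≥ 1`: on the open unit box,
`|1/(a − x₀x₁)| ≤ 1/(1 − x₀x₁)`. [folklore] -/
theorem abs_dilogIntegrand_le_of_one_le {a : ℝ} (ha : 1 ≤ a) {x : Fin 2 → ℝ}
    (hx : ∀ i, x i ∈ Set.Ioo (0:ℝ) 1) :
    |1 / (a - x 0 * x 1)| ≤ 1 / (1 - x 0 * x 1) := by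
  have hp := mul_mem_Ioo_of_mem_box hx
  have h1 : 0 < 1 - x 0 * x 1 := sub_pos.2 hp.2
  have h2 : 1 - x 0 * x 1 ≤ a - x 0 * x 1 := by linarith
  rw [abs_of_pos (one_div_pos.2 (h1.trans_le h2))]
  exact one_div_le_one_div_of_le h1 h2

/-- Domination of the dilogarithm integrand for `a < 0`: on the open unit box,
`|1/(a − x₀x₁)| ≤ (1/(−a))/(1 − x₀x₁)`. [folklore] -/
theorem abs_dilogIntegrand_le_of_neg {a : ℝ} (ha : a < 0) {x : Fin 2 → ℝ}
    (hx : ∀ i, x i ∈ Set.Ioo (0:ℝ) 1) :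
    |1 / (a - x 0 * x 1)| ≤ 1 / (-a) / (1 - x 0 * x 1) := by
  have hp := mul_mem_Ioo_of_mem_box hx
  have h1 : 0 < 1 - x 0 * x 1 := sub_pos.2 hp.2
  have ha' : 0 < -a := neg_pos.2 ha
  rw [abs_div, abs_one, abs_of_neg (show a - x 0 * x 1 < 0 by linarith [hp.1]), neg_sub]
  calc 1 / (x 0 * x 1 - a) ≤ 1 / (-a) := one_div_le_one_div_of_le ha' (by linarith [hp.1])
    _ ≤ 1 / (-a) / (1 - x 0 * x 1) :=
      le_div_self (one_div_pos.2 ha').le h1 (by linarith [hp.1])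

/-- The log-product denominator `(b + x₀)(c + x₁)` is at least `bc > 0` on the open unit box when
`b, c > 0`. [folklore] -/
theorem mul_le_logProdDen {b c : ℝ} (hb : 0 < b) (hc : 0 < c) {x : Fin 2 → ℝ}
    (hx : ∀ i, x i ∈ Set.Ioo (0:ℝ) 1) : b * c ≤ (b + x 0) * (c + x 1) :=
  mul_le_mul (le_add_of_nonneg_right (hx 0).1.le) (le_add_of_nonneg_right (hx 1).1.le) hc.le
    (by linarith [(hx 0).1])

/-- Domination of the log-product integrand: on the open unit box,
`|1/((b + x₀)(c + x₁))| ≤ (1/(bc))/(1 − x₀x₁)` for `b, c > 0`. [folklore] -/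
theorem abs_logProdIntegrand_le {b c : ℝ} (hb : 0 < b) (hc : 0 < c) {x : Fin 2 → ℝ}
    (hx : ∀ i, x i ∈ Set.Ioo (0:ℝ) 1) :
    |1 / ((b + x 0) * (c + x 1))| ≤ 1 / (b * c) / (1 - x 0 * x 1) := by
  have hp := mul_mem_Ioo_of_mem_box hx
  have h1 : 0 < 1 - x 0 * x 1 := sub_pos.2 hp.2
  have hbc : 0 < b * c := mul_pos hb hc
  have hle := mul_le_logProdDen hb hc hx
  rw [abs_of_pos (one_div_pos.2 (hbc.trans_le hle))]
  calc 1 / ((b + x 0) * (c + x 1)) ≤ 1 / (b * c) := one_div_le_one_div_of_le hbc hle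
    _ ≤ 1 / (b * c) / (1 - x 0 * x 1) :=
      le_div_self (one_div_pos.2 hbc).le h1 (by linarith [hp.1])

/-- The squares-substitution denominator `a² − x₀²x₁²` is at least `1 − x₀x₁ > 0` on the open unit
box when `|a| ≥ 1` (since `x₀²x₁² ≤ x₀x₁ ≤ 1 ≤ a²`). [folklore] -/
theorem one_sub_mul_le_squaresDen {a : ℝ} (ha : 1 ≤ |a|) {x : Fin 2 → ℝ}
    (hx : ∀ i, x i ∈ Set.Ioo (0:ℝ) 1) : 1 - x 0 * x 1 ≤ a ^ 2 - x 0 ^ 2 * x 1 ^ 2 := by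
  have hp := mul_mem_Ioo_of_mem_box hx
  have ha2 : 1 ≤ a ^ 2 := (one_le_sq_iff_one_le_abs a).2 ha
  have hq : x 0 ^ 2 * x 1 ^ 2 ≤ x 0 * x 1 := by
    rw [← mul_pow]
    exact pow_le_of_le_one hp.1.le hp.2.le two_ne_zero
  linarith

/-- Domination of the squares-substitution integrand: on the open unit box,
`|4x₀x₁/(a² − x₀²x₁²)| ≤ 4/(1 − x₀x₁)` for `|a| ≥ 1`. [folklore] -/
theorem abs_squaresIntegrand_le {a : ℝ} (ha : 1 ≤ |a|) {x : Fin 2 → ℝ}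
    (hx : ∀ i, x i ∈ Set.Ioo (0:ℝ) 1) :
    |4 * x 0 * x 1 / (a ^ 2 - x 0 ^ 2 * x 1 ^ 2)| ≤ 4 / (1 - x 0 * x 1) := by
  have hp := mul_mem_Ioo_of_mem_box hx
  have h1 : 0 < 1 - x 0 * x 1 := sub_pos.2 hp.2
  have hden := one_sub_mul_le_squaresDen ha hx
  have hnum : 0 ≤ 4 * x 0 * x 1 := by linarith [hp.1]
  rw [abs_of_nonneg (div_nonneg hnum (h1.le.trans hden))]
  exact div_le_div₀ (by norm_num) (by linarith [hp.2]) h1 hden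

/-! ## Absolute convergence: domination by Beukers' kernel -/

/-- **Domination principle on the unit box.** A function continuous on the open unit box of `ℝ²`
and dominated there by `C/(1 − x₀x₁)` is integrable on the box: Beukers' kernel `1/(1 − x₀x₁)` is
integrable on the box (its integral is `ζ(2)`; seat c7's `LevelOne.integrableOn_aeval_div_one_sub_mul`).
[cite: KontsevichZagier2001, §1.1] -/
theorem integrableOn_box_of_abs_le {f : (Fin 2 → ℝ) → ℝ} (C : ℝ)
    (hf : ContinuousOn f {x | ∀ i, x i ∈ Set.Ioo (0:ℝ) 1})
    (hle : ∀ x : Fin 2 → ℝ, (∀ i, x i ∈ Set.Ioo (0:ℝ) 1) → |f x| ≤ C / (1 - x 0 * x 1)) :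
    IntegrableOn f {x | ∀ i, x i ∈ Set.Ioo (0:ℝ) 1} := by
  have hS : MeasurableSet {x : Fin 2 → ℝ | ∀ i, x i ∈ Set.Ioo (0:ℝ) 1} :=
    (isSemialgebraic_box 2).measurableSet_holds
  have hg := (LevelOne.integrableOn_aeval_div_one_sub_mul 1).const_mul C
  refine Integrable.mono' hg (hf.aestronglyMeasurable hS)
    (ae_restrict_of_forall_mem hS fun x hx => ?_)
  rw [Real.norm_eq_abs, map_one, ← mul_div_assoc, mul_one]
  exact hle x hx

/-- **Absolute convergence of the dilogarithm integrand.** For `a ≥ 1` or `a < 0`,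
`1/(a − x₀x₁)` is integrable on the open unit box (dominated by `max(1, 1/(−a))/(1 − x₀x₁)`).
[cite: KontsevichZagier2001, §1.1] -/
theorem integrableOn_dilogIntegrand {a : ℝ} (ha : 1 ≤ a ∨ a < 0) :
    IntegrableOn (fun x : Fin 2 → ℝ => 1 / (a - x 0 * x 1)) {x | ∀ i, x i ∈ Set.Ioo (0:ℝ) 1} := by
  have hcont : ContinuousOn (fun x : Fin 2 → ℝ => 1 / (a - x 0 * x 1))
      {x | ∀ i, x i ∈ Set.Ioo (0:ℝ) 1} :=
    ContinuousOn.div continuousOn_const (by fun_prop) fun x hx => dilogDen_ne_zero ha hx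
  rcases ha with ha | ha
  · exact integrableOn_box_of_abs_le 1 hcont fun x hx => abs_dilogIntegrand_le_of_one_le ha hx
  · exact integrableOn_box_of_abs_le (1 / (-a)) hcont fun x hx => abs_dilogIntegrand_le_of_neg ha hx

/-- **Absolute convergence of the log-product integrand.** For `b, c > 0`,
`1/((b + x₀)(c + x₁))` is integrable on the open unit box (it is bounded by `1/(bc)`).
[cite: KontsevichZagier2001, §1.1] -/
theorem integrableOn_logProdIntegrand {b c : ℝ} (hb : 0 < b) (hc : 0 < c) :
    IntegrableOn (fun x : Fin 2 → ℝ => 1 / ((b + x 0) * (c + x 1)))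
      {x | ∀ i, x i ∈ Set.Ioo (0:ℝ) 1} := by
  have hcont : ContinuousOn (fun x : Fin 2 → ℝ => 1 / ((b + x 0) * (c + x 1)))
      {x | ∀ i, x i ∈ Set.Ioo (0:ℝ) 1} :=
    ContinuousOn.div continuousOn_const (by fun_prop) fun x hx =>
      ((mul_pos hb hc).trans_le (mul_le_logProdDen hb hc hx)).ne'
  exact integrableOn_box_of_abs_le (1 / (b * c)) hcont fun x hx => abs_logProdIntegrand_le hb hc hx

/-- **Absolute convergence of the squares-substitution integrand.** For `|a| ≥ 1`,
`4x₀x₁/(a² − x₀²x₁²)` is integrable on the open unit box (dominated by `4/(1 − x₀x₁)`).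
[cite: KontsevichZagier2001, §1.1] -/
theorem integrableOn_squaresIntegrand {a : ℝ} (ha : 1 ≤ |a|) :
    IntegrableOn (fun x : Fin 2 → ℝ => 4 * x 0 * x 1 / (a ^ 2 - x 0 ^ 2 * x 1 ^ 2))
      {x | ∀ i, x i ∈ Set.Ioo (0:ℝ) 1} := by
  have hcont : ContinuousOn (fun x : Fin 2 → ℝ => 4 * x 0 * x 1 / (a ^ 2 - x 0 ^ 2 * x 1 ^ 2))
      {x | ∀ i, x i ∈ Set.Ioo (0:ℝ) 1} :=
    ContinuousOn.div (by fun_prop) (by fun_prop) fun x hx =>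
      ((sub_pos.2 (mul_mem_Ioo_of_mem_box hx).2).trans_le (one_sub_mul_le_squaresDen ha hx)).ne'
  exact integrableOn_box_of_abs_le 4 hcont fun x hx => abs_squaresIntegrand_le ha hx

/-! ## Semialgebraicity of the integrands -/

/-- **Semialgebraicity of the dilogarithm integrand.** For real algebraic `a` with `a ≥ 1` or
`a < 0`, `x ↦ 1/(a − x₀x₁)` is a `ℚ`-semialgebraic function on the open unit box: the constant `a`
is `ℚ`-semialgebraic (`isSemialgebraicFunOn_const_of_isAlgebraic`), and semialgebraic functions are
closed under ring operations and quotients by non-vanishing denominators.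
[cite: KontsevichZagier2001, §1.1] -/
theorem isSemialgebraicFunOn_dilogIntegrand {a : ℝ} (ha : IsAlgebraic ℚ a) (ha' : 1 ≤ a ∨ a < 0) :
    IsSemialgebraicFunOn ℚ {x : Fin 2 → ℝ | ∀ i, x i ∈ Set.Ioo (0:ℝ) 1}
      (fun x => 1 / (a - x 0 * x 1)) := by
  have hB := isSemialgebraic_box 2
  have hden : IsSemialgebraicFunOn ℚ {x : Fin 2 → ℝ | ∀ i, x i ∈ Set.Ioo (0:ℝ) 1}
      (fun x => a - x 0 * x 1) :=
    (IsSemialgebraicFunOn.sub_holds (isSemialgebraicFunOn_const_of_isAlgebraic hB ha)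
      (IsSemialgebraicFunOn.mul_holds (isSemialgebraicFunOn_apply hB 0)
        (isSemialgebraicFunOn_apply hB 1))).congr fun _ _ => rfl
  exact ((isSemialgebraicFunOn_const_of_isAlgebraic hB isAlgebraic_one).div hden
    fun x hx => dilogDen_ne_zero ha' hx).congr fun _ _ => rfl

/-- **Semialgebraicity of the log-product integrand.** For real algebraic `b, c > 0`,
`x ↦ 1/((b + x₀)(c + x₁))` is a `ℚ`-semialgebraic function on the open unit box.
[cite: KontsevichZagier2001, §1.1] -/
theorem isSemialgebraicFunOn_logProdIntegrand {b c : ℝ} (hb : IsAlgebraic ℚ b) (hc : IsAlgebraic ℚ c)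
    (hb0 : 0 < b) (hc0 : 0 < c) :
    IsSemialgebraicFunOn ℚ {x : Fin 2 → ℝ | ∀ i, x i ∈ Set.Ioo (0:ℝ) 1}
      (fun x => 1 / ((b + x 0) * (c + x 1))) := by
  have hB := isSemialgebraic_box 2
  have hden : IsSemialgebraicFunOn ℚ {x : Fin 2 → ℝ | ∀ i, x i ∈ Set.Ioo (0:ℝ) 1}
      (fun x => (b + x 0) * (c + x 1)) :=
    (IsSemialgebraicFunOn.mul_holds
      (IsSemialgebraicFunOn.add_holds (isSemialgebraicFunOn_const_of_isAlgebraic hB hb)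
        (isSemialgebraicFunOn_apply hB 0))
      (IsSemialgebraicFunOn.add_holds (isSemialgebraicFunOn_const_of_isAlgebraic hB hc)
        (isSemialgebraicFunOn_apply hB 1))).congr fun _ _ => rfl
  exact ((isSemialgebraicFunOn_const_of_isAlgebraic hB isAlgebraic_one).div hden
    fun x hx => ((mul_pos hb0 hc0).trans_le (mul_le_logProdDen hb0 hc0 hx)).ne').congr
    fun _ _ => rfl

/-- **Semialgebraicity of the squares-substitution integrand.** For real algebraic `a` with
`|a| ≥ 1`, `x ↦ 4x₀x₁/(a² − x₀²x₁²)` is a `ℚ`-semialgebraic function on the open unit box (the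
numerator and `x₀²x₁²` are `ℚ`-polynomials, the constant `a²` is real algebraic).
[cite: KontsevichZagier2001, §1.1] -/
theorem isSemialgebraicFunOn_squaresIntegrand {a : ℝ} (ha : IsAlgebraic ℚ a) (ha1 : 1 ≤ |a|) :
    IsSemialgebraicFunOn ℚ {x : Fin 2 → ℝ | ∀ i, x i ∈ Set.Ioo (0:ℝ) 1}
      (fun x => 4 * x 0 * x 1 / (a ^ 2 - x 0 ^ 2 * x 1 ^ 2)) := by
  have hB := isSemialgebraic_box 2
  have hnum : IsSemialgebraicFunOn ℚ {x : Fin 2 → ℝ | ∀ i, x i ∈ Set.Ioo (0:ℝ) 1}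
      (fun x => 4 * x 0 * x 1) :=
    (isSemialgebraicFunOn_aeval hB
      (4 * MvPolynomial.X 0 * MvPolynomial.X 1 : MvPolynomial (Fin 2) ℚ)).congr fun x _ => by
      simp only [map_mul, map_ofNat, MvPolynomial.aeval_X]
  have hden : IsSemialgebraicFunOn ℚ {x : Fin 2 → ℝ | ∀ i, x i ∈ Set.Ioo (0:ℝ) 1}
      (fun x => a ^ 2 - x 0 ^ 2 * x 1 ^ 2) :=
    (IsSemialgebraicFunOn.sub_holds (isSemialgebraicFunOn_const_of_isAlgebraic hB (ha.pow 2))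
      (isSemialgebraicFunOn_aeval hB
        (MvPolynomial.X 0 ^ 2 * MvPolynomial.X 1 ^ 2 : MvPolynomial (Fin 2) ℚ))).congr
      fun x _ => by simp only [Pi.sub_apply, map_mul, map_pow, MvPolynomial.aeval_X]
  exact (hnum.div hden fun x hx => ((sub_pos.2 (mul_mem_Ioo_of_mem_box hx).2).trans_le
    (one_sub_mul_le_squaresDen ha1 hx)).ne').congr fun _ _ => rfl

/-! ## Existence of the atoms -/

/-- **The dilogarithm box exists.** For real algebraic `a` with `a ≥ 1` or `a < 0`,
`D(a) = [(0,1)², 1/(a − x₀x₁)]` is an integral representation of the Kontsevich–Zagier calculus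
(value `Li₂(1/a) = Σ_{n ≥ 1} a^{-n}/n²`; `D(1)` is Beukers' `ζ(2)` box).
[cite: KontsevichZagier2001, §1.1] -/
theorem exists_dilogBox {a : ℝ} (ha : IsAlgebraic ℚ a) (ha' : 1 ≤ a ∨ a < 0) :
    ∃ N : IntegralRep 2, N.domain = {x | ∀ i, x i ∈ Set.Ioo (0:ℝ) 1} ∧
      N.integrand = fun x => 1 / (a - x 0 * x 1) :=
  ⟨⟨_, _, isSemialgebraic_box 2, isSemialgebraicFunOn_dilogIntegrand ha ha',
    integrableOn_dilogIntegrand ha'⟩, rfl, rfl⟩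

/-- **The log-product box exists.** For real algebraic `b, c > 0`,
`P(b,c) = [(0,1)², 1/((b + x₀)(c + x₁))]` is an integral representation of the Kontsevich–Zagier
calculus (value `log(1 + 1/b)·log(1 + 1/c)`). [cite: KontsevichZagier2001, §1.1] -/
theorem exists_logProdBox {b c : ℝ} (hb : IsAlgebraic ℚ b) (hc : IsAlgebraic ℚ c)
    (hb0 : 0 < b) (hc0 : 0 < c) :
    ∃ P : IntegralRep 2, P.domain = {x | ∀ i, x i ∈ Set.Ioo (0:ℝ) 1} ∧
      P.integrand = fun x => 1 / ((b + x 0) * (c + x 1)) :=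
  ⟨⟨_, _, isSemialgebraic_box 2, isSemialgebraicFunOn_logProdIntegrand hb hc hb0 hc0,
    integrableOn_logProdIntegrand hb0 hc0⟩, rfl, rfl⟩

/-- **The squares-substitution box exists.** For real algebraic `a` with `|a| ≥ 1`,
`W(a) = [(0,1)², 4x₀x₁/(a² − x₀²x₁²)]` is an integral representation of the Kontsevich–Zagier
calculus (the pull-back of `D(a²)` along the squaring map `(x₀, x₁) ↦ (x₀², x₁²)`).
[cite: KontsevichZagier2001, §1.1] -/
theorem exists_squaresBox {a : ℝ} (ha : IsAlgebraic ℚ a) (ha1 : 1 ≤ |a|) :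
    ∃ W : IntegralRep 2, W.domain = {x | ∀ i, x i ∈ Set.Ioo (0:ℝ) 1} ∧
      W.integrand = fun x => 4 * x 0 * x 1 / (a ^ 2 - x 0 ^ 2 * x 1 ^ 2) :=
  ⟨⟨_, _, isSemialgebraic_box 2, isSemialgebraicFunOn_squaresIntegrand ha ha1,
    integrableOn_squaresIntegrand ha1⟩, rfl, rfl⟩

/-! ## The registered sub-goal -/

/-- **Stub S1a (existence of the box atoms of the dilogarithm layer; registered sub-goal
`exists_boxAtoms` of stmt-KontsevichZagierPeriods-3869, line `SketchIdeator1`).** On the open unit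
box `(0,1)² ⊆ ℝ²`: (i) for every real algebraic `a` with `a ≥ 1` or `a < 0` the dilogarithm box
`[(0,1)², 1/(a − x₀x₁)]` exists; (ii) for all real algebraic `b, c > 0` the log-product box
`[(0,1)², 1/((b + x₀)(c + x₁))]` exists; (iii) for every real algebraic `a` with `|a| ≥ 1` the
squares-substitution box `[(0,1)², 4x₀x₁/(a² − x₀²x₁²)]` exists — each as an integral
representation of the Kontsevich–Zagier calculus with literally these domains and integrands.
[cite: KontsevichZagier2001, §1.1] -/
theorem exists_boxAtoms :
    (∀ a : ℝ, IsAlgebraic ℚ a → (1 ≤ a ∨ a < 0) →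
      ∃ N : IntegralRep 2, N.domain = {x | ∀ i, x i ∈ Set.Ioo (0:ℝ) 1} ∧
        N.integrand = fun x => 1 / (a - x 0 * x 1)) ∧
    (∀ b c : ℝ, IsAlgebraic ℚ b → IsAlgebraic ℚ c → 0 < b → 0 < c →
      ∃ P : IntegralRep 2, P.domain = {x | ∀ i, x i ∈ Set.Ioo (0:ℝ) 1} ∧
        P.integrand = fun x => 1 / ((b + x 0) * (c + x 1))) ∧
    (∀ a : ℝ, IsAlgebraic ℚ a → 1 ≤ |a| →
      ∃ W : IntegralRep 2, W.domain = {x | ∀ i, x i ∈ Set.Ioo (0:ℝ) 1} ∧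
        W.integrand = fun x => 4 * x 0 * x 1 / (a ^ 2 - x 0 ^ 2 * x 1 ^ 2)) :=
  ⟨fun _ ha ha' => exists_dilogBox ha ha', fun _ _ hb hc hb0 hc0 => exists_logProdBox hb hc hb0 hc0,
    fun _ ha ha1 => exists_squaresBox ha ha1⟩

end Summit.KontsevichZagierPeriods.HurwitzMicroSectors.NormalFormPrinciple.PiBox.Dilog
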